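import Summits.BirchSwinnertonDyer.Rank1Residual.GaloisImage.VisibleIndexBudget
import Summits.BirchSwinnertonDyer.Rank1Residual.GaloisImage.MordellWeilIndexCertificatesThreeInstance
import Summits.BirchSwinnertonDyer.Rank1Residual.GaloisImage.LocalThreeTorsionBoundOfMu
import Summits.BirchSwinnertonDyer.Rank1Residual.GaloisImage.LocalThreeTorsionAdicCompletionAt
import Summits.BirchSwinnertonDyer.Rank1Residual.X11b.VisibilityPrimeList
import HarnessLib

/-!
# PILOT: `Ш(E)[3] ≠ 0` for the PASS-rank3 row `313992q1 ~ 134568g1` by the COUNT road with the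
# kernel index certificate `27 ≤ [E′(ℚ):3E′(ℚ)]` (team n1011, row T-DIV3L, FILE D15)

HONEST FRAMING (cell `b2b-bsdres`, run/shared/lean/b2b/bsd-rank1-residual/, verbatim in every
file): the goal of the cell is to DELETE the COMBINATION-SHAPED residual classes of the
Birch–Swinnerton-Dyer formula for ALL analytic-rank `≤ 1` elliptic curves over `ℚ` — "full BSD
formula for every rank `≤ 1` curve in class `C`" assembled STRICTLY from published theorems — so
that the rank-`≤ 1` remainder becomes exactly the CONSTRUCTION-SHAPED classes, which are TYPED
(missing-input `Prop`s), NOT attempted. This is not "finishing BSD". Team n1011 (N10/N11): research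
route; this file is a per-pair KERNEL INSTANCE (EVIDENCE-level pilot: it proves `Ш(E)[3] ≠ 0` for ONE
pair GIVEN `θ`, finiteness and coprimality — it closes nothing by itself; the BSDp record with its
EVIDENCE binders is the records lanes'); nothing is booked; no mark / label moved; X4 stays
CONSTRUCTION-SHAPED. THEOREMS only; no definition, no named fact, no `sorry`.

## What

r1's row `313992q1 ~ 134568g1` (`route1/g29_cvis_pairs.tsv`: verdict PASS-rank3, `S = 2:add-pg/
add-pg:1 ; 3:add-pm/add-pg:3:PAY3 ; 7:add-pg/nonsplit:1 ; 89:split/split:1`, cost 9 < budget 27):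
`E = 313992q1 = [0,0,0,−31899,−4557098]` (X4, `r_an = 0`), `E′ = 134568g1 = [0,0,0,−327,2410]`
(Cremona rank 3). The count road in the `hvis` currency (FILE D13
`exists_sha_three_torsion_of_congr_of_index_of_primeList`) with EVERY local and global numeral
decided in the kernel:
* `L = [2, 3, 7, 89]` supports both discriminants (x11c's factorisation certificates
  `X11b.forall_mem_of_natAbs_eq_prod_pow`: `|Δ(E₀)| = 2¹¹·3⁸·7⁸·89`, `|Δ(F₀)| = 2⁸·3⁵·7²·89`);
* `#E′(ℚ_v)[3] = 1` at `2, 7, 89` by T-LOC3L FILE L5 certificates (`threeTorsionCheckAt … = some 0`);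
* the costly place `3`: `#E′(ℚ₃)[3] ≤ 3` by FILE D14 (`μ₃(ℚ₃) = 1`, Weil pairing — no certificate);
* `27 ≤ [E′(ℚ):3E′(ℚ)]` by FILE D12's kernel instance `twentyseven_le_index_134568g1` (three
  generators, ten chords, thirteen NO-primes), the thirteen `Nonsingular` facts discharged here by
  `equation_iff_nonsingular` + `norm_num`;
* budget `3 · 3 = 9 < 27`.
Displayed (NOT discharged): `θ : E′[3] ≅ E[3]` with `hθ`, `Finite E(ℚ)`, `(#E(ℚ), 3) = 1`.
A second row of the same shape, `40401h1 ~ 363609a1` (`L = [3, 67]`), with its own index instance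
`twentyseven_le_index_363609a1` (points checked on the curve by `norm_num`), shows the recipe is
uniform over r1's 27 PASS-rank3 rows (inputs: `gen9/census/T-IDX27-PASSRANK3-INPUTS.md`).

References: [CremonaMazur2000] §3; [AgasheStein2002] Thm. 3.1; [Cremona2006] (labels).
-/

set_option autoImplicit false

open WeierstrassCurve NumberField IsDedekindDomain Rat.HeightOneSpectrum Field
  Literature.NumberTheory.EllipticCurves Literature.NumberTheory.GaloisRepresentations
open Summit.BirchSwinnertonDyer.Rank1Residual.GaloisImage.LocalTorsion3At
  (threeTorsionCheckAt natCard_ker_nsmul_three_adicCompletion_eq_of_checkAt)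
open Summit.BirchSwinnertonDyer.Rank1Residual

namespace Summit.BirchSwinnertonDyer.Rank1Residual.GaloisImage.DivisionDecider

/-- A point satisfying the Weierstrass equation of an elliptic curve is nonsingular (Mathlib
`equation_iff_nonsingular`), with the equation as a ring identity. [folklore] -/
theorem nonsingular_of_eq (W' : WeierstrassCurve ℚ) [W'.IsElliptic] {x y : ℚ}
    (h : y ^ 2 + W'.a₁ * x * y + W'.a₃ * y = x ^ 3 + W'.a₂ * x ^ 2 + W'.a₄ * x + W'.a₆) :
    W'.toAffine.Nonsingular x y :=
  W'.toAffine.equation_iff_nonsingular.mp ((WeierstrassCurve.Affine.equation_iff x y).mpr h)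

/-- **PILOT `313992q1 ~ 134568g1` (PASS-rank3): `Ш(E/ℚ)[3] ≠ 0` in the `hvis` currency** from
`θ`, `Finite E(ℚ)`, coprimality — everything else decided in the kernel: factorisation certificates
for `L = [2,3,7,89]`, T-LOC3L certificates at `2, 7, 89`, the Weil-pairing bound at `3` (D14), the
index certificate `27 ≤ [E′:3E′]` (D12) with its thirteen points checked on the curve by `norm_num`,
and `3·3 < 27`. [cite: CremonaMazur2000, §3 pp. 19–22] [cite: Cremona2006, Table 1 (Cremona labels 313992q1, 134568g1)] -/
theorem exists_sha_three_torsion_313992q1 (W W' : WeierstrassCurve ℚ) [W.IsElliptic] [W'.IsElliptic]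
    (hW : W = ⟨0, 0, 0, -31899, -4557098⟩) (hW' : W' = ⟨0, 0, 0, -327, 2410⟩)
    (θ : geomTorsion W' ((3 : ℕ) : ℤ) ≃+ geomTorsion W ((3 : ℕ) : ℤ))
    (hθ : ∀ (σ : Field.absoluteGaloisGroup ℚ) (P : geomTorsion W' ((3 : ℕ) : ℤ)),
      θ (σ • P) = σ • θ P)
    (hfin : Finite W.toAffine.Point) (hcop : (Nat.card W.toAffine.Point).Coprime 3) :
    ∃ c : W.sha, c ≠ 0 ∧ (3 : ℕ) • c = 0 := by
  haveI : Fact (Nat.Prime 2) := ⟨Nat.prime_two⟩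
  haveI : Fact (Nat.Prime 7) := ⟨by norm_num⟩
  haveI : Fact (Nat.Prime 89) := ⟨by norm_num⟩
  -- the index certificate `27 ≤ [E′:3E′]` in the classical currency of the count theorem
  have hidx := twentyseven_le_index_134568g1 W' hW'
    (nonsingular_of_eq W' (by subst hW'; norm_num)) (nonsingular_of_eq W' (by subst hW'; norm_num))
    (nonsingular_of_eq W' (by subst hW'; norm_num)) (nonsingular_of_eq W' (by subst hW'; norm_num))
    (nonsingular_of_eq W' (by subst hW'; norm_num)) (nonsingular_of_eq W' (by subst hW'; norm_num))
    (nonsingular_of_eq W' (by subst hW'; norm_num)) (nonsingular_of_eq W' (by subst hW'; norm_num))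
    (nonsingular_of_eq W' (by subst hW'; norm_num)) (nonsingular_of_eq W' (by subst hW'; norm_num))
    (nonsingular_of_eq W' (by subst hW'; norm_num)) (nonsingular_of_eq W' (by subst hW'; norm_num))
    (nonsingular_of_eq W' (by subst hW'; norm_num)) (fun a b => Classical.propDecidable (a = b))
  refine exists_sha_three_torsion_of_congr_of_index_of_primeList W W' θ hθ hfin hcop
    (E₀ := ⟨0, 0, 0, -31899, -4557098⟩) (F₀ := ⟨0, 0, 0, -327, 2410⟩)
    (by subst hW; ext <;> simp [WeierstrassCurve.map])
    (by subst hW'; ext <;> simp [WeierstrassCurve.map])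
    [2, 3, 7, 89] (by decide)
    (X11b.forall_mem_of_natAbs_eq_prod_pow [2, 3, 7, 89] [11, 8, 8, 1] (by decide +kernel)
      (by decide +kernel))
    (X11b.forall_mem_of_natAbs_eq_prod_pow [2, 3, 7, 89] [8, 5, 2, 1] (by decide +kernel)
      (by decide +kernel))
    Nat.prime_three (by decide) (t := 3)
    (fun v hv => natCard_ker_nsmul_three_adicCompletion_le_three_at3 W' hv)
    (fun v hvL hv3 => ?_) (m := 27) (by norm_num) hidx
  -- the free places `2, 7, 89`: `#E′(ℚ_v)[3] = 1` by T-LOC3L certificates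
  have hcases : (primesEquiv v : ℕ) = 2 ∨ (primesEquiv v : ℕ) = 7 ∨ (primesEquiv v : ℕ) = 89 := by
    simp only [List.mem_cons, List.mem_nil_iff, or_false] at hvL
    omega
  rcases hcases with h2 | h7 | h89
  · exact (natCard_ker_nsmul_three_adicCompletion_eq_of_checkAt 2 0 0 0 (-327) 2410 (by norm_num)
      (by decide) (k := 2) (S := 0) (cert := []) (by decide +kernel) W' hW' h2).trans (by norm_num)
  · exact (natCard_ker_nsmul_three_adicCompletion_eq_of_checkAt 7 0 0 0 (-327) 2410 (by norm_num)
      (by decide) (k := 1) (S := 0) (cert := [((1 : ℤ), 0, 1, 0)]) (by decide +kernel) W' hW' h7).trans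
      (by norm_num)
  · exact (natCard_ker_nsmul_three_adicCompletion_eq_of_checkAt 89 0 0 0 (-327) 2410 (by norm_num)
      (by decide) (k := 1) (S := 0) (cert := [((64 : ℤ), 0, 1, 0)]) (by decide +kernel) W' hW' h89).trans
      (by norm_num)

/-- **Index instance `363609a1`** (`[0, 0, 1, -201, 1122]`, Cremona rank 3; r1 PASS-rank3 row `40401h1 ~ 363609a1`):
generators `(0, 33)`, `(67/9, 154/27)`, `(15, 38)`, the ten compound points and
thirteen NO-primes `[3, 31, 3, 3, 3, 19, 3, 3, 3, 19, 3, 19, 3]` (census `gen9/census/idx27_certs.json`); the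
thirteen points checked ON the curve by `norm_num` (`nonsingular_of_eq`), chords and certificates by
`decide +kernel` after `clear d`. [folklore] -/
theorem twentyseven_le_index_363609a1 (W' : WeierstrassCurve ℚ) [W'.IsElliptic]
    (hW' : W' = ⟨0, 0, 1, -201, 1122⟩) (d : DecidableEq ℚ) :
    27 ≤ (letI : DecidableEq ℚ := d
      (zsmulAddGroupHom ((3 : ℕ) : ℤ) : W'.toAffine.Point →+ W'.toAffine.Point).range.index) :=
  twentyseven_le_index_range_zsmul_three_of_checks 0 0 1 (-201) 1122 W' hW'
    (x₁ := 0) (y₁ := 33) (x₂ := (67 / 9)) (y₂ := (154 / 27))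
    (x₃ := 15) (y₃ := 38)
    (u₁ := 6) (v₁ := (-12))
    (u₂ := 21) (v₂ := 78)
    (u₃ := (-134 / 9)) (v₃ := (-784 / 27))
    (u₄ := (201 / 25)) (v₄ := (574 / 125))
    (u₅ := (-1206 / 289)) (v₅ := (211039 / 4913))
    (u₆ := (201 / 16)) (v₆ := (1509 / 64))
    (u₇ := (799 / 81)) (v₇ := (-7631 / 729))
    (u₈ := (-12)) (v₈ := (-43))
    (u₉ := (76 / 9)) (v₉ := (127 / 27))
    (u₁₀ := (1377 / 4)) (v₁₀ := (-51059 / 8))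
    (nonsingular_of_eq W' (by clear d; subst hW'; norm_num))
    (nonsingular_of_eq W' (by clear d; subst hW'; norm_num))
    (nonsingular_of_eq W' (by clear d; subst hW'; norm_num))
    (nonsingular_of_eq W' (by clear d; subst hW'; norm_num))
    (nonsingular_of_eq W' (by clear d; subst hW'; norm_num))
    (nonsingular_of_eq W' (by clear d; subst hW'; norm_num))
    (nonsingular_of_eq W' (by clear d; subst hW'; norm_num))
    (nonsingular_of_eq W' (by clear d; subst hW'; norm_num))
    (nonsingular_of_eq W' (by clear d; subst hW'; norm_num))
    (nonsingular_of_eq W' (by clear d; subst hW'; norm_num))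
    (nonsingular_of_eq W' (by clear d; subst hW'; norm_num))
    (nonsingular_of_eq W' (by clear d; subst hW'; norm_num))
    (nonsingular_of_eq W' (by clear d; subst hW'; norm_num))
    (by norm_num) (by norm_num) (by norm_num) (by norm_num) (by norm_num)
    (by clear d; subst hW'; decide +kernel) (by clear d; subst hW'; decide +kernel)
    (by clear d; subst hW'; decide +kernel) (by clear d; subst hW'; decide +kernel)
    (by clear d; subst hW'; decide +kernel) (by clear d; subst hW'; decide +kernel)
    (by clear d; subst hW'; decide +kernel) (by clear d; subst hW'; decide +kernel)
    (by clear d; subst hW'; decide +kernel) (by clear d; subst hW'; decide +kernel)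
    (by clear d; subst hW'; decide +kernel) (by clear d; subst hW'; decide +kernel)
    (by clear d; subst hW'; decide +kernel) (by clear d; subst hW'; decide +kernel)
    (by clear d; subst hW'; decide +kernel) (by clear d; subst hW'; decide +kernel)
    (by clear d; subst hW'; decide +kernel) (by clear d; subst hW'; decide +kernel)
    (by clear d; subst hW'; decide +kernel) (by clear d; subst hW'; decide +kernel)
    (ℓ₁ := 3) (ℓ₂ := 31) (ℓ₃ := 3) (ℓ₄ := 3) (ℓ₅ := 3) (ℓ₆ := 19) (ℓ₇ := 3) (ℓ₈ := 3) (ℓ₉ := 3)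
    (ℓ₁₀ := 19) (ℓ₁₁ := 3) (ℓ₁₂ := 19) (ℓ₁₃ := 3)
    (hℓ₁ := ⟨Nat.prime_three⟩) (hℓ₂ := ⟨by norm_num⟩) (hℓ₃ := ⟨Nat.prime_three⟩)
    (hℓ₄ := ⟨Nat.prime_three⟩) (hℓ₅ := ⟨Nat.prime_three⟩) (hℓ₆ := ⟨by norm_num⟩)
    (hℓ₇ := ⟨Nat.prime_three⟩) (hℓ₈ := ⟨Nat.prime_three⟩) (hℓ₉ := ⟨Nat.prime_three⟩)
    (hℓ₁₀ := ⟨by norm_num⟩) (hℓ₁₁ := ⟨Nat.prime_three⟩) (hℓ₁₂ := ⟨by norm_num⟩)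
    (hℓ₁₃ := ⟨Nat.prime_three⟩)
    (k₁ := 1) (k₂ := 1) (k₃ := 1) (k₄ := 1) (k₅ := 1) (k₆ := 1) (k₇ := 1) (k₈ := 1) (k₉ := 1)
    (k₁₀ := 1) (k₁₁ := 1) (k₁₂ := 1) (k₁₃ := 1)
    (by decide +kernel) (by decide +kernel) (by decide +kernel) (by decide +kernel)
    (by decide +kernel) (by decide +kernel) (by decide +kernel) (by decide +kernel)
    (by decide +kernel) (by decide +kernel) (by decide +kernel) (by decide +kernel)
    (by decide +kernel) d

/-- **PILOT `40401h1 ~ 363609a1` (PASS-rank3, `L = [3, 67]`): `Ш(E/ℚ)[3] ≠ 0` in the `hvis`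
currency** — the same recipe: factorisation certificates (`|Δ(E₀)| = 3^7·67^9`,
`|Δ(F₀)| = 3^4·67^3`), `#E′(ℚ₆₇)[3] = 1` by an L5 certificate, the place `3` by D14, the
index certificate `twentyseven_le_index_363609a1`, budget `3·3 < 27`.
[cite: CremonaMazur2000, §3 pp. 19–22] [cite: Cremona2006, Table 1 (Cremona labels 40401h1, 363609a1)] -/
theorem exists_sha_three_torsion_40401h1 (W W' : WeierstrassCurve ℚ) [W.IsElliptic] [W'.IsElliptic]
    (hW : W = ⟨1, -1, 0, -1071468, 211224915⟩) (hW' : W' = ⟨0, 0, 1, -201, 1122⟩)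
    (θ : geomTorsion W' ((3 : ℕ) : ℤ) ≃+ geomTorsion W ((3 : ℕ) : ℤ))
    (hθ : ∀ (σ : Field.absoluteGaloisGroup ℚ) (P : geomTorsion W' ((3 : ℕ) : ℤ)),
      θ (σ • P) = σ • θ P)
    (hfin : Finite W.toAffine.Point) (hcop : (Nat.card W.toAffine.Point).Coprime 3) :
    ∃ c : W.sha, c ≠ 0 ∧ (3 : ℕ) • c = 0 := by
  haveI : Fact (Nat.Prime 67) := ⟨by norm_num⟩
  have hidx := twentyseven_le_index_363609a1 W' hW' (fun a b => Classical.propDecidable (a = b))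
  refine exists_sha_three_torsion_of_congr_of_index_of_primeList W W' θ hθ hfin hcop
    (E₀ := ⟨1, -1, 0, -1071468, 211224915⟩) (F₀ := ⟨0, 0, 1, -201, 1122⟩)
    (by subst hW; ext <;> simp [WeierstrassCurve.map])
    (by subst hW'; ext <;> simp [WeierstrassCurve.map])
    [3, 67] (by decide)
    (X11b.forall_mem_of_natAbs_eq_prod_pow [3, 67] [7, 9] (by decide +kernel)
      (by decide +kernel))
    (X11b.forall_mem_of_natAbs_eq_prod_pow [3, 67] [4, 3] (by decide +kernel)
      (by decide +kernel))
    Nat.prime_three (by decide) (t := 3)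
    (fun v hv => natCard_ker_nsmul_three_adicCompletion_le_three_at3 W' hv)
    (fun v hvL hv3 => ?_) (m := 27) (by norm_num) hidx
  have h67 : (primesEquiv v : ℕ) = 67 := by
    simp only [List.mem_cons, List.mem_nil_iff, or_false] at hvL
    omega
  exact (natCard_ker_nsmul_three_adicCompletion_eq_of_checkAt 67 0 0 1 (-201) 1122 (by norm_num)
    (by decide) (k := 1) (S := 0) (cert := []) (by decide +kernel) W' hW' h67).trans (by norm_num)

end Summit.BirchSwinnertonDyer.Rank1Residual.GaloisImage.DivisionDecider
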